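import Literature.Topology.FourManifolds.CerfExcellentPaths
import Literature.Topology.FourManifolds.CerfBirthDeathCurve
import Literature.Topology.FourManifolds.CerfPolynomialDirectionsMulti
import HarnessLib

/-!
# Genericity of the height functions of a moving sphere after a small polynomial shear
# (Cerf 1968, Ch. II §3: Lemme 9 and Prop. 7, 1°–2°, in almost-everywhere form)

Topic `Literature/Topology/FourManifolds` (programme of the fact
`Literature.Topology.FourManifolds.cerf_pi0DiffDisc_relBoundary_three`, brick C1, sphere level).
Cerf (LNM 53 (1968), Ch. II §3) transports the genericity theory of paths of functions on a
compact surface (§2: correct and excellent paths, Déf. 1–2) to paths of embedded 2-spheres of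
`ℝ³` through the height function `ϖ ∘ j` (Lemme 9: `ℱ → ℱ/𝒦 → 𝒳` is open with path lifting, so
`ℱ⁰ ∪ ℱ¹`, the preimage of `𝒳⁰ ∪ 𝒳¹`, is open dense and paths of spheres can be made excellent).
This file is the finite-dimensional, measure-theoretic form of that transport for a smooth
one-parameter family `F : ℝ → ℝ³ → ℝ³` moving the unit sphere (`F t` injective and immersive on
`S²`): the sphere is read in the two **stereographic parametrisations** `stereoInv s : ℝ² → S²`
(`s = 0, 1`: from the north and south poles), the height of the moving sphere SHEARED by the
polynomial `q_p = ∑ p_α X^α` (`(x, y, z) ↦ (x, y, z + q_p)`) is the perturbed family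
`heightP F p s = perturb (heightChart F s) (polyDir (chartMap F s)) p` of `CerfPathJets`, the
monomial directions span all multijets (`CerfPolynomialDirections(Multi)`), and the seven
a.e. statements of `CerfExcellentPaths` give:

* `ae_genericity_sphere` — **for almost every polynomial shear `p` (degree `≤ 11`), at every
  time `t` and in every chart: (T0′) no critical point of the slice with vanishing second jet;
  (Déf. 1) correctness at degenerate critical points; (C₁) transverse crossing of the critical
  values of any two distinct critical points with equal values; (C₂) at most one degenerate
  critical point; (C₃) no three distinct critical points with equal values; (C₄) no degenerate
  critical point together with an equal-valued pair; (C₅) no two equal-valued pairs** — the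
  density half of Prop. 7 1°–2° for the family `t ↦ F t (S²)`, the input of the finiteness and
  local-structure analysis of the events of a generic path (BD points `CerfBirthDeathCurve`,
  crossings `CerfCrossing`).

Also: the stereographic parametrisations (`stereoInv`, smooth, injective immersions onto the
sphere, left inverse `stereoProj`), the chart readings `chartMap F s (t, x) = F t (stereoInv s x)`
and the immersivity of their slices (`linearIndependent_fderiv_chartMap`).

## References
* [CerfDiffeoSphere1968] J. Cerf, *Sur les difféomorphismes de la sphère de dimension trois
  (Γ₄ = 0)*, LNM 53 (1968), Ch. II §3, Lemme 9, Prop. 7; §2, Déf. 1–2; §1 (Thom).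
-/

noncomputable section

open Set Function Filter Module MeasureTheory
open scoped ContDiff Topology BigOperators

namespace Literature.Topology.FourManifolds

namespace CerfPath

open Literature.Analysis.Calculus Literature.Analysis.Calculus.MvPoly
  Literature.Analysis.Calculus.ParametricTransversality

/-- Local notation: the model plane. -/
local notation "𝔼²" => EuclideanSpace ℝ (Fin 2)
/-- Local notation: the ambient space. -/
local notation "𝔼³" => EuclideanSpace ℝ (Fin 3)

/-! ### The two stereographic parametrisations of the unit sphere -/

/-- The sign of the pole of chart `s`: `+1` for `s = 0`, `-1` for `s = 1`. [folklore] -/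
def pole (s : Fin 2) : ℝ := if s = 0 then 1 else -1

/-- `pole s` is a sign. [folklore] -/
theorem pole_mul_self (s : Fin 2) : pole s * pole s = 1 := by
  unfold pole; split_ifs <;> norm_num

/-- `0 < 1 + ‖x‖²`. [folklore] -/
theorem one_add_norm_sq_pos (x : 𝔼²) : 0 < 1 + ‖x‖ ^ 2 := by positivity

/-- **Inverse stereographic projection** from the pole `(0, 0, pole s)`:
`x ↦ (2x₀, 2x₁, pole s (‖x‖² - 1)) / (1 + ‖x‖²)`, a parametrisation of the unit sphere minus
that pole by the plane. [folklore] -/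
def stereoInv (s : Fin 2) (x : 𝔼²) : 𝔼³ :=
  (1 + ‖x‖ ^ 2)⁻¹ • (!₂[2 * x 0, 2 * x 1, pole s * (‖x‖ ^ 2 - 1)] : 𝔼³)

/-- First component of `stereoInv`. [folklore] -/
theorem stereoInv_apply_zero (s : Fin 2) (x : 𝔼²) :
    stereoInv s x 0 = (1 + ‖x‖ ^ 2)⁻¹ * (2 * x 0) := by
  simp [stereoInv]

/-- Second component of `stereoInv`. [folklore] -/
theorem stereoInv_apply_one (s : Fin 2) (x : 𝔼²) :
    stereoInv s x 1 = (1 + ‖x‖ ^ 2)⁻¹ * (2 * x 1) := by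
  simp [stereoInv]

/-- Third component of `stereoInv`. [folklore] -/
theorem stereoInv_apply_two (s : Fin 2) (x : 𝔼²) :
    stereoInv s x 2 = (1 + ‖x‖ ^ 2)⁻¹ * (pole s * (‖x‖ ^ 2 - 1)) := by
  simp [stereoInv]

/-- `‖X‖² = X₀² + X₁² + X₂²` on `ℝ³`. [folklore] -/
theorem norm_sq_eq_three (X : 𝔼³) : ‖X‖ ^ 2 = X 0 ^ 2 + X 1 ^ 2 + X 2 ^ 2 := by
  rw [EuclideanSpace.norm_eq, Real.sq_sqrt (Finset.sum_nonneg fun i _ => sq_nonneg _)]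
  simp [Fin.sum_univ_three, sq_abs]

/-- **`stereoInv s x` lies on the unit sphere.** [folklore] -/
theorem norm_stereoInv (s : Fin 2) (x : 𝔼²) : ‖stereoInv s x‖ = 1 := by
  have hr := one_add_norm_sq_pos x
  have hc : (1 + ‖x‖ ^ 2)⁻¹ * (1 + ‖x‖ ^ 2) = 1 := inv_mul_cancel₀ hr.ne'
  have hp := pole_mul_self s
  have h2 := norm_sq_eq_two x
  have hsq : ‖stereoInv s x‖ ^ 2 = 1 := by
    rw [norm_sq_eq_three, stereoInv_apply_zero, stereoInv_apply_one, stereoInv_apply_two]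
    rw [h2] at hc ⊢
    linear_combination
      ((1 + (x 0 ^ 2 + x 1 ^ 2))⁻¹ ^ 2 * (x 0 ^ 2 + x 1 ^ 2 - 1) ^ 2) * hp +
        ((1 + (x 0 ^ 2 + x 1 ^ 2))⁻¹ * (1 + (x 0 ^ 2 + x 1 ^ 2)) + 1) * hc
  have h0 : 0 ≤ ‖stereoInv s x‖ := norm_nonneg _
  nlinarith [hsq, h0]

/-- `stereoInv s x ∈ S²`. [folklore] -/
theorem stereoInv_mem_sphere (s : Fin 2) (x : 𝔼²) : stereoInv s x ∈ Metric.sphere (0 : 𝔼³) 1 := by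
  rw [mem_sphere_zero_iff_norm, norm_stereoInv]

/-- **`stereoInv s` is smooth.** [folklore] -/
theorem contDiff_stereoInv (s : Fin 2) : ContDiff ℝ ∞ (stereoInv s) := by
  have hr : ContDiff ℝ ∞ fun x : 𝔼² => (1 + ‖x‖ ^ 2)⁻¹ :=
    (contDiff_const.add (contDiff_norm_sq ℝ)).inv fun x => (one_add_norm_sq_pos x).ne'
  have hn : ContDiff ℝ ∞ fun x : 𝔼² => ‖x‖ ^ 2 := contDiff_norm_sq ℝ
  have hv : ContDiff ℝ ∞ fun x : 𝔼² =>
      (!₂[2 * x 0, 2 * x 1, pole s * (‖x‖ ^ 2 - 1)] : 𝔼³) := by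
    rw [contDiff_euclidean]
    intro i
    fin_cases i
    · simp only [Fin.zero_eta, Fin.isValue, Matrix.cons_val_zero]; fun_prop
    · simp only [Fin.mk_one, Fin.isValue, Matrix.cons_val_one, Matrix.cons_val_zero]
      fun_prop
    · simp only [Fin.reduceFinMk, Matrix.cons_val]
      exact contDiff_const.mul (hn.sub contDiff_const)
  exact hr.smul hv

/-- **Stereographic projection** from the pole `(0, 0, pole s)` (a left inverse of `stereoInv s`,
smooth off the plane `pole s · X₂ = 1`). [folklore] -/
def stereoProj (s : Fin 2) (X : 𝔼³) : 𝔼² := (1 - pole s * X 2)⁻¹ • (!₂[X 0, X 1] : 𝔼²)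

/-- The denominator of `stereoProj` along `stereoInv`: `1 - pole s · (stereoInv s x)₂ = 2/(1+‖x‖²)`.
[folklore] -/
theorem one_sub_pole_mul_stereoInv (s : Fin 2) (x : 𝔼²) :
    1 - pole s * stereoInv s x 2 = 2 * (1 + ‖x‖ ^ 2)⁻¹ := by
  rw [stereoInv_apply_two]
  have hp := pole_mul_self s
  have hc : (1 + ‖x‖ ^ 2)⁻¹ * (1 + ‖x‖ ^ 2) = 1 := inv_mul_cancel₀ (one_add_norm_sq_pos x).ne'
  linear_combination (-(1 + ‖x‖ ^ 2)⁻¹ * (‖x‖ ^ 2 - 1)) * hp - hc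

/-- **`stereoProj s ∘ stereoInv s = id`.** [folklore] -/
theorem stereoProj_stereoInv (s : Fin 2) (x : 𝔼²) : stereoProj s (stereoInv s x) = x := by
  have h := one_sub_pole_mul_stereoInv s x
  have hr : (1 + ‖x‖ ^ 2) ≠ 0 := (one_add_norm_sq_pos x).ne'
  ext i
  fin_cases i
  · simp [stereoProj, h, stereoInv_apply_zero]
    field_simp
  · simp [stereoProj, h, stereoInv_apply_one]
    field_simp

/-- `stereoInv s` is injective. [folklore] -/
theorem injective_stereoInv (s : Fin 2) : Injective (stereoInv s) :=
  (LeftInverse.injective (g := stereoProj s) (stereoProj_stereoInv s))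

/-- `stereoProj s` is smooth where its denominator does not vanish. [folklore] -/
theorem contDiffAt_stereoProj (s : Fin 2) {X : 𝔼³} (hX : 1 - pole s * X 2 ≠ 0) :
    ContDiffAt ℝ ∞ (stereoProj s) X := by
  have h1 : ContDiffAt ℝ ∞ (fun X : 𝔼³ => (1 - pole s * X 2)⁻¹) X := by
    refine ContDiffAt.inv ?_ hX
    fun_prop
  have h2 : ContDiff ℝ ∞ fun X : 𝔼³ => (!₂[X 0, X 1] : 𝔼²) := by
    rw [contDiff_euclidean]
    intro i
    fin_cases i
    · simp only [Fin.zero_eta, Fin.isValue, Matrix.cons_val_zero]; fun_prop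
    · simp only [Fin.mk_one, Fin.isValue, Matrix.cons_val_one, Matrix.cons_val_zero]
      fun_prop
  exact h1.smul h2.contDiffAt

/-- **`stereoInv s` is an immersion**: its derivative is injective everywhere (chain rule on
`stereoProj s ∘ stereoInv s = id`). [folklore] -/
theorem injective_fderiv_stereoInv (s : Fin 2) (x : 𝔼²) :
    Injective (fderiv ℝ (stereoInv s) x) := by
  have hX : 1 - pole s * stereoInv s x 2 ≠ 0 := by
    rw [one_sub_pole_mul_stereoInv]
    exact mul_ne_zero two_ne_zero (inv_ne_zero (one_add_norm_sq_pos x).ne')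
  have hπ : DifferentiableAt ℝ (stereoProj s) (stereoInv s x) :=
    (contDiffAt_stereoProj s hX).differentiableAt (by simp)
  have hc : DifferentiableAt ℝ (stereoInv s) x :=
    (contDiff_stereoInv s).differentiable (by simp) x
  have hcomp : fderiv ℝ (stereoProj s ∘ stereoInv s) x =
      (fderiv ℝ (stereoProj s) (stereoInv s x)).comp (fderiv ℝ (stereoInv s) x) :=
    fderiv_comp x hπ hc
  have hid : stereoProj s ∘ stereoInv s = id := funext (stereoProj_stereoInv s)
  rw [hid, fderiv_id] at hcomp
  intro v w hvw
  have h := congrArg (fderiv ℝ (stereoProj s) (stereoInv s x)) hvw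
  rw [← ContinuousLinearMap.comp_apply, ← hcomp, ← ContinuousLinearMap.comp_apply, ← hcomp] at h
  simpa using h

/-! ### Chart readings of a moving sphere -/

variable {F : ℝ → 𝔼³ → 𝔼³} {d : ℕ}

/-- The chart reading `(t, x) ↦ F t (stereoInv s x)` of the moving embedding in chart `s`.
[cite: CerfDiffeoSphere1968, Ch. II §3 (j : S² → ℝ³ read in charts)] -/
def chartMap (F : ℝ → 𝔼³ → 𝔼³) (s : Fin 2) : ℝ × 𝔼² → 𝔼³ := fun z => F z.1 (stereoInv s z.2)

/-- Unfolding of `chartMap`. [folklore] -/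
theorem chartMap_apply (F : ℝ → 𝔼³ → 𝔼³) (s : Fin 2) (z : ℝ × 𝔼²) :
    chartMap F s z = F z.1 (stereoInv s z.2) := rfl

/-- The chart reading is smooth when the family is jointly smooth. [folklore] -/
theorem contDiff_chartMap (hF : ContDiff ℝ ∞ (uncurry F)) (s : Fin 2) :
    ContDiff ℝ ∞ (chartMap F s) := by
  have h := hF.comp (contDiff_fst.prodMk ((contDiff_stereoInv s).comp contDiff_snd) :
    ContDiff ℝ ∞ fun z : ℝ × 𝔼² => (z.1, stereoInv s z.2))
  exact h

/-- Each `F t` is smooth when the family is jointly smooth. [folklore] -/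
theorem contDiff_member_of_uncurry (hF : ContDiff ℝ ∞ (uncurry F)) (t : ℝ) :
    ContDiff ℝ ∞ (F t) := by
  have h := hF.comp (contDiff_const.prodMk contDiff_id : ContDiff ℝ ∞ fun ξ : 𝔼³ => (t, ξ))
  exact h

/-- **The slice partials of the chart reading**: `∂ᵢ(F_t ∘ stereoInv s)(x) =
DF_t(stereoInv s x) (D(stereoInv s)(x) eᵢ)`. [folklore] -/
theorem fderiv_chartMap_dir (hF : ContDiff ℝ ∞ (uncurry F)) (s : Fin 2) (z : ℝ × 𝔼²)
    (i : Fin 2) :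
    fderiv ℝ (chartMap F s) z (dir i) =
      fderiv ℝ (F z.1) (stereoInv s z.2) (fderiv ℝ (stereoInv s) z.2 (EuclideanSpace.single i 1)) := by
  have hΦ : Differentiable ℝ (chartMap F s) := (contDiff_chartMap hF s).differentiable (by simp)
  -- the slice of the chart reading is `F t ∘ stereoInv s`
  have hslice : fderiv ℝ (fun x => chartMap F s (z.1, x)) z.2 (EuclideanSpace.single i 1) =
      fderiv ℝ (chartMap F s) z (dir i) := by
    rw [(hasFDerivAt_slice (hΦ z).hasFDerivAt).fderiv, dir]
    simp
  rw [← hslice]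
  have hfun : (fun x => chartMap F s (z.1, x)) = F z.1 ∘ stereoInv s := rfl
  have hFt : DifferentiableAt ℝ (F z.1) (stereoInv s z.2) :=
    (contDiff_member_of_uncurry hF z.1).differentiable (by simp) _
  have hc : DifferentiableAt ℝ (stereoInv s) z.2 :=
    (contDiff_stereoInv s).differentiable (by simp) _
  rw [hfun, fderiv_comp z.2 hFt hc]
  rfl

/-- **The slices of the chart readings are immersions** when each `F t` is an immersion along
the sphere: the two slice partials are linearly independent.
[cite: CerfDiffeoSphere1968, Ch. II §3] -/
theorem linearIndependent_fderiv_chartMap (hF : ContDiff ℝ ∞ (uncurry F))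
    (himm : ∀ t, ∀ ξ ∈ Metric.sphere (0 : 𝔼³) 1, Injective (fderiv ℝ (F t) ξ)) (s : Fin 2)
    (z : ℝ × 𝔼²) :
    LinearIndependent ℝ (fun i : Fin 2 => fderiv ℝ (chartMap F s) z (dir i)) := by
  have hL : Injective ((fderiv ℝ (F z.1) (stereoInv s z.2)).comp (fderiv ℝ (stereoInv s) z.2)) :=
    (himm z.1 _ (stereoInv_mem_sphere s z.2)).comp (injective_fderiv_stereoInv s z.2)
  have hb : LinearIndependent ℝ (fun i : Fin 2 => EuclideanSpace.single i (1 : ℝ)) := by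
    rw [Fintype.linearIndependent_iff]
    intro g hg i
    fin_cases i
    · have h := congrArg (fun v : 𝔼² => v 0) hg
      simpa [Fin.sum_univ_two] using h
    · have h := congrArg (fun v : 𝔼² => v 1) hg
      simpa [Fin.sum_univ_two] using h
  have hker : LinearMap.ker (((fderiv ℝ (F z.1) (stereoInv s z.2)).comp
      (fderiv ℝ (stereoInv s) z.2) : 𝔼² →L[ℝ] 𝔼³) : 𝔼² →ₗ[ℝ] 𝔼³) = ⊥ :=
    LinearMap.ker_eq_bot.2 hL
  have h := hb.map' _ hker
  have hfun : (fun i : Fin 2 => fderiv ℝ (chartMap F s) z (dir i)) =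
      (((fderiv ℝ (F z.1) (stereoInv s z.2)).comp (fderiv ℝ (stereoInv s) z.2) :
        𝔼² →L[ℝ] 𝔼³) : 𝔼² →ₗ[ℝ] 𝔼³) ∘ fun i : Fin 2 => EuclideanSpace.single i (1 : ℝ) := by
    funext i
    rw [fderiv_chartMap_dir hF s z i]
    rfl
  rw [hfun]
  exact h

/-- Distinct points of the sphere have distinct images under an injective `F t`: the chart
readings of two charts at `(t, x)`, `(t, y)` with `stereoInv a x ≠ stereoInv b y` differ.
[folklore] -/
theorem chartMap_ne (hinj : ∀ t, InjOn (F t) (Metric.sphere (0 : 𝔼³) 1)) {a b : Fin 2} {t : ℝ}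
    {x y : 𝔼²} (hne : stereoInv a x ≠ stereoInv b y) :
    chartMap F a (t, x) ≠ chartMap F b (t, y) := fun h =>
  hne (hinj t (stereoInv_mem_sphere a x) (stereoInv_mem_sphere b y) h)

/-! ### The perturbed height functions -/

/-- The chart reading of the HEIGHT (`z`-coordinate, Cerf's `ϖ ∘ j`) of the moving sphere in
chart `s`. [cite: CerfDiffeoSphere1968, Ch. II §3, `ϖ ∘ j`] -/
def heightChart (F : ℝ → 𝔼³ → 𝔼³) (s : Fin 2) : ℝ × 𝔼² → ℝ := fun z => chartMap F s z 2

/-- The chart reading of the height of the moving sphere SHEARED by the polynomial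
`q_p = ∑ p_α X^α`, `(x, y, z) ↦ (x, y, z + q_p(x, y, z))`: the perturbed family
`heightChart + ∑ p_α (X^α ∘ chartMap)` of `CerfPathJets.perturb`.
[cite: CerfDiffeoSphere1968, Ch. II §3 and §1 (finite-dimensional probe of Thom's theorem)] -/
def heightP (F : ℝ → 𝔼³ → 𝔼³) (p : MIdx d → ℝ) (s : Fin 2) : ℝ × 𝔼² → ℝ :=
  perturb (heightChart F s) (polyDir (chartMap F s)) p

/-- Unfolding of `heightP`. [folklore] -/
theorem heightP_def (F : ℝ → 𝔼³ → 𝔼³) (p : MIdx d → ℝ) (s : Fin 2) :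
    heightP F p s = perturb (heightChart F s) (polyDir (chartMap F s)) p := rfl

/-- **Geometric meaning**: `heightP F p s (t, x)` is the height of the sheared image
`X + q_p(X) e₃` of the point `X = F t (stereoInv s x)` of the moving sphere. [folklore] -/
theorem heightP_apply (F : ℝ → 𝔼³ → 𝔼³) (p : MIdx d → ℝ) (s : Fin 2) (z : ℝ × 𝔼²) :
    heightP F p s z = (F z.1 (stereoInv s z.2)) 2 + toFun (polyOf p) (F z.1 (stereoInv s z.2)) := by
  have h := congrFun (toFun_polyOf_comp p (chartMap F s)) z
  simp only [perturb_apply, Pi.zero_apply, zero_add] at h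
  rw [heightP, perturb_apply, ← h]
  rfl

/-- The height chart reading is smooth. [folklore] -/
theorem contDiff_heightChart (hF : ContDiff ℝ ∞ (uncurry F)) (s : Fin 2) :
    ContDiff ℝ ∞ (heightChart F s) := by
  have h : ContDiff ℝ ∞ fun X : 𝔼³ => X 2 := by fun_prop
  exact h.comp (contDiff_chartMap hF s)

/-- The monomial directions of the chart reading are smooth. [folklore] -/
theorem contDiff_polyDir_chartMap (hF : ContDiff ℝ ∞ (uncurry F)) (s : Fin 2) (α : MIdx d) :
    ContDiff ℝ ∞ (polyDir (chartMap F s) α) :=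
  contDiff_polyDir (contDiff_chartMap hF s) α

/-! ### Genericity for almost every shear -/

section Generic

variable (hF : ContDiff ℝ ∞ (uncurry F))
  (hinj : ∀ t, InjOn (F t) (Metric.sphere (0 : 𝔼³) 1))
  (himm : ∀ t, ∀ ξ ∈ Metric.sphere (0 : 𝔼³) 1, Injective (fderiv ℝ (F t) ξ))

include hF himm in
/-- One-point spanning for the chart readings (degree `d ≥ 2`). [folklore] -/
theorem surjective_D012_chartMap (hd : 2 ≤ d) (s : Fin 2) (z : ℝ × 𝔼²) :
    Surjective (D012 (polyDir (d := d) (chartMap F s)) z) :=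
  surjective_D012_polyDir hd (contDiff_chartMap hF s) (linearIndependent_fderiv_chartMap hF himm s z)

include hF hinj himm in
/-- Two-point spanning for the chart readings at distinct points of the sphere (`d ≥ 5`).
[folklore] -/
theorem surjective_D012_chartMap_pair (hd : 5 ≤ d) (a b : Fin 2) (t : ℝ) {x y : 𝔼²}
    (hne : stereoInv a x ≠ stereoInv b y) :
    Surjective ((D012 (polyDir (d := d) (chartMap F a)) (t, x)).prod
      (D012 (polyDir (d := d) (chartMap F b)) (t, y))) :=
  surjective_D012_polyDir_pair hd (contDiff_chartMap hF a) (contDiff_chartMap hF b)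
    (linearIndependent_fderiv_chartMap hF himm a (t, x))
    (linearIndependent_fderiv_chartMap hF himm b (t, y)) (chartMap_ne hinj hne)

include hF hinj himm in
/-- Three-point spanning for the chart readings at pairwise distinct points (`d ≥ 8`).
[folklore] -/
theorem surjective_D012_chartMap_triple (hd : 8 ≤ d) (a b c : Fin 2) (t : ℝ) {x y u : 𝔼²}
    (hab : stereoInv a x ≠ stereoInv b y) (hac : stereoInv a x ≠ stereoInv c u)
    (hbc : stereoInv b y ≠ stereoInv c u) :
    Surjective ((D012 (polyDir (d := d) (chartMap F a)) (t, x)).prod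
      ((D012 (polyDir (d := d) (chartMap F b)) (t, y)).prod
        (D012 (polyDir (d := d) (chartMap F c)) (t, u)))) :=
  surjective_D012_polyDir_triple hd (contDiff_chartMap hF a) (contDiff_chartMap hF b)
    (contDiff_chartMap hF c)
    (linearIndependent_fderiv_chartMap hF himm a (t, x))
    (linearIndependent_fderiv_chartMap hF himm b (t, y))
    (linearIndependent_fderiv_chartMap hF himm c (t, u))
    (chartMap_ne hinj hab) (chartMap_ne hinj hac) (chartMap_ne hinj hbc)

include hF hinj himm in
/-- Four-point spanning for the chart readings at pairwise distinct points (`d ≥ 11`).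
[folklore] -/
theorem surjective_D012_chartMap_quadruple (hd : 11 ≤ d) (a b c e : Fin 2) (t : ℝ)
    {x y u v : 𝔼²}
    (hab : stereoInv a x ≠ stereoInv b y) (hac : stereoInv a x ≠ stereoInv c u)
    (hae : stereoInv a x ≠ stereoInv e v) (hbc : stereoInv b y ≠ stereoInv c u)
    (hbe : stereoInv b y ≠ stereoInv e v) (hce : stereoInv c u ≠ stereoInv e v) :
    Surjective (((D012 (polyDir (d := d) (chartMap F a)) (t, x)).prod
      (D012 (polyDir (d := d) (chartMap F b)) (t, y))).prod
      ((D012 (polyDir (d := d) (chartMap F c)) (t, u)).prod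
        (D012 (polyDir (d := d) (chartMap F e)) (t, v)))) :=
  surjective_D012_polyDir_quadruple hd (contDiff_chartMap hF a) (contDiff_chartMap hF b)
    (contDiff_chartMap hF c) (contDiff_chartMap hF e)
    (linearIndependent_fderiv_chartMap hF himm a (t, x))
    (linearIndependent_fderiv_chartMap hF himm b (t, y))
    (linearIndependent_fderiv_chartMap hF himm c (t, u))
    (linearIndependent_fderiv_chartMap hF himm e (t, v))
    (chartMap_ne hinj hab) (chartMap_ne hinj hac) (chartMap_ne hinj hae)
    (chartMap_ne hinj hbc) (chartMap_ne hinj hbe) (chartMap_ne hinj hce)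

/-- The stereographic parametrisations are continuous. [folklore] -/
theorem continuous_stereoInv (s : Fin 2) : Continuous (stereoInv s) :=
  (contDiff_stereoInv s).continuous

include hF himm in
/-- **(T0′) a.e.: no critical point of a slice with vanishing second jet**, in every chart.
[cite: CerfDiffeoSphere1968, Ch. II §2, Premier temps (p. 14); §3, Prop. 7 1°] -/
theorem ae_sphere_jet2_ne_zero :
    ∀ᵐ p ∂(volume : Measure (MIdx 11 → ℝ)), ∀ (s : Fin 2) (z : ℝ × 𝔼²),
      d1 (heightP F p s) z = 0 → jet2 (heightP F p s) z ≠ 0 := by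
  rw [ae_all_iff]
  intro s
  exact ae_jet2_ne_zero (contDiff_heightChart hF s) (contDiff_polyDir_chartMap hF s)
    (surjective_D012_chartMap hF himm (by norm_num) s)

include hF himm in
/-- **(Déf. 1) a.e.: correctness** — at a degenerate critical point of a slice with non-zero
second jet, `(λ, x, y) ↦ (p, q, δ)` has onto derivative, in every chart.
[cite: CerfDiffeoSphere1968, Ch. II §2, Déf. 1, Prop. 1; §3, Prop. 7 1°] -/
theorem ae_sphere_correct :
    ∀ᵐ p ∂(volume : Measure (MIdx 11 → ℝ)), ∀ (s : Fin 2) (z : ℝ × 𝔼²),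
      jet2 (heightP F p s) z ≠ 0 → d1 (heightP F p s) z = 0 → hessDet (heightP F p s) z = 0 →
        Surjective (fderiv ℝ (fun z => (d1 (heightP F p s) z, hessDet (heightP F p s) z)) z) := by
  rw [ae_all_iff]
  intro s
  exact ae_correct (contDiff_heightChart hF s) (contDiff_polyDir_chartMap hF s)
    (surjective_D012_chartMap hF himm (by norm_num) s)

include hF hinj himm in
/-- **(C₁) a.e.: transverse double points** — two distinct points of the sphere, critical for
the slice at one `λ` with equal values, give an onto derivative of
`(λ, x, x′) ↦ (p, q, p′, q′, z - z′)`, in every pair of charts.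
[cite: CerfDiffeoSphere1968, Ch. II §2, Déf. 2 (1), (12)–(13); §3, Prop. 7 1°] -/
theorem ae_sphere_transverse_double :
    ∀ᵐ p ∂(volume : Measure (MIdx 11 → ℝ)), ∀ (a b : Fin 2) (t : ℝ) (x y : 𝔼²),
      stereoInv a x ≠ stereoInv b y →
      d1 (heightP F p a) (t, x) = 0 → d1 (heightP F p b) (t, y) = 0 →
      heightP F p a (t, x) = heightP F p b (t, y) →
        Surjective (fderiv ℝ (fun q : ℝ × (𝔼² × 𝔼²) =>
          (d1 (heightP F p a) (q.1, q.2.1), d1 (heightP F p b) (q.1, q.2.2),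
            heightP F p a (q.1, q.2.1) - heightP F p b (q.1, q.2.2))) (t, (x, y))) := by
  rw [ae_all_iff]; intro a
  rw [ae_all_iff]; intro b
  have hD : IsOpen {q : 𝔼² × 𝔼² | stereoInv a q.1 ≠ stereoInv b q.2} :=
    isOpen_ne_fun ((continuous_stereoInv a).comp continuous_fst)
      ((continuous_stereoInv b).comp continuous_snd)
  exact ae_transverse_double (contDiff_heightChart hF a) (contDiff_polyDir_chartMap hF a)
    (contDiff_heightChart hF b) (contDiff_polyDir_chartMap hF b) hD
    (fun t x y hxy => surjective_D012_chartMap_pair hF hinj himm (by norm_num) a b t hxy)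

include hF hinj himm in
/-- **(C₂) a.e.: at most one degenerate critical point per slice** (among points with non-zero
second jets), in every pair of charts.
[cite: CerfDiffeoSphere1968, Ch. II §2, Déf. 2 (2); §3, Prop. 7 1°] -/
theorem ae_sphere_atMostOne_degenerate :
    ∀ᵐ p ∂(volume : Measure (MIdx 11 → ℝ)), ∀ (a b : Fin 2) (t : ℝ) (x y : 𝔼²),
      stereoInv a x ≠ stereoInv b y →
      jet2 (heightP F p a) (t, x) ≠ 0 → jet2 (heightP F p b) (t, y) ≠ 0 →
      ¬ (d1 (heightP F p a) (t, x) = 0 ∧ hessDet (heightP F p a) (t, x) = 0 ∧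
         d1 (heightP F p b) (t, y) = 0 ∧ hessDet (heightP F p b) (t, y) = 0) := by
  rw [ae_all_iff]; intro a
  rw [ae_all_iff]; intro b
  have hD : IsOpen {q : 𝔼² × 𝔼² | stereoInv a q.1 ≠ stereoInv b q.2} :=
    isOpen_ne_fun ((continuous_stereoInv a).comp continuous_fst)
      ((continuous_stereoInv b).comp continuous_snd)
  exact ae_atMostOne_degenerate (contDiff_heightChart hF a) (contDiff_polyDir_chartMap hF a)
    (contDiff_heightChart hF b) (contDiff_polyDir_chartMap hF b) hD
    (fun t x y hxy => surjective_D012_chartMap_pair hF hinj himm (by norm_num) a b t hxy)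

/-- The admissible set of triples: pairwise distinct points of the sphere, read in charts
`a, b, c`. It is open. [folklore] -/
theorem isOpen_tripleSet (a b c : Fin 2) :
    IsOpen {q : 𝔼² × (𝔼² × 𝔼²) | stereoInv a q.1 ≠ stereoInv b q.2.1 ∧
      stereoInv a q.1 ≠ stereoInv c q.2.2 ∧ stereoInv b q.2.1 ≠ stereoInv c q.2.2} := by
  refine (isOpen_ne_fun ?_ ?_).inter ((isOpen_ne_fun ?_ ?_).inter (isOpen_ne_fun ?_ ?_))
  · exact (continuous_stereoInv a).comp continuous_fst
  · exact (continuous_stereoInv b).comp (continuous_fst.comp continuous_snd)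
  · exact (continuous_stereoInv a).comp continuous_fst
  · exact (continuous_stereoInv c).comp (continuous_snd.comp continuous_snd)
  · exact (continuous_stereoInv b).comp (continuous_fst.comp continuous_snd)
  · exact (continuous_stereoInv c).comp (continuous_snd.comp continuous_snd)

include hF hinj himm in
/-- **(C₃) a.e.: no three distinct critical points of a slice with equal values**, in every
triple of charts. [cite: CerfDiffeoSphere1968, Ch. II §2, Déf. 2 (3); §3, Prop. 7 1°] -/
theorem ae_sphere_no_triple_value :
    ∀ᵐ p ∂(volume : Measure (MIdx 11 → ℝ)), ∀ (a b c : Fin 2) (t : ℝ) (x y u : 𝔼²),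
      stereoInv a x ≠ stereoInv b y → stereoInv a x ≠ stereoInv c u →
      stereoInv b y ≠ stereoInv c u →
      ¬ (d1 (heightP F p a) (t, x) = 0 ∧ d1 (heightP F p b) (t, y) = 0 ∧
         d1 (heightP F p c) (t, u) = 0 ∧
         heightP F p a (t, x) = heightP F p b (t, y) ∧
         heightP F p b (t, y) = heightP F p c (t, u)) := by
  rw [ae_all_iff]; intro a
  rw [ae_all_iff]; intro b
  rw [ae_all_iff]; intro c
  have h := ae_no_triple_value (contDiff_heightChart hF a) (contDiff_polyDir_chartMap hF a)
    (contDiff_heightChart hF b) (contDiff_polyDir_chartMap hF b)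
    (contDiff_heightChart hF c) (contDiff_polyDir_chartMap hF c) (isOpen_tripleSet a b c)
    (fun t x y u hq => surjective_D012_chartMap_triple hF hinj himm (d := 11) (by norm_num) a b c t
      hq.1 hq.2.1 hq.2.2)
  filter_upwards [h] with p hp t x y u hab hac hbc
  exact hp t x y u ⟨hab, hac, hbc⟩

include hF hinj himm in
/-- **(C₄) a.e.: no degenerate critical point together with an equal-valued pair of critical
points** (three distinct points of the sphere), in every triple of charts.
[cite: CerfDiffeoSphere1968, Ch. II §2, Déf. 2 (4); §3, Prop. 7 1°] -/
theorem ae_sphere_no_degenerate_and_double :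
    ∀ᵐ p ∂(volume : Measure (MIdx 11 → ℝ)), ∀ (a b c : Fin 2) (t : ℝ) (x y u : 𝔼²),
      stereoInv a x ≠ stereoInv b y → stereoInv a x ≠ stereoInv c u →
      stereoInv b y ≠ stereoInv c u →
      jet2 (heightP F p c) (t, u) ≠ 0 →
      ¬ (d1 (heightP F p a) (t, x) = 0 ∧ d1 (heightP F p b) (t, y) = 0 ∧
         heightP F p a (t, x) = heightP F p b (t, y) ∧
         d1 (heightP F p c) (t, u) = 0 ∧ hessDet (heightP F p c) (t, u) = 0) := by
  rw [ae_all_iff]; intro a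
  rw [ae_all_iff]; intro b
  rw [ae_all_iff]; intro c
  have h := ae_no_degenerate_and_double (contDiff_heightChart hF a)
    (contDiff_polyDir_chartMap hF a)
    (contDiff_heightChart hF b) (contDiff_polyDir_chartMap hF b)
    (contDiff_heightChart hF c) (contDiff_polyDir_chartMap hF c) (isOpen_tripleSet a b c)
    (fun t x y u hq => surjective_D012_chartMap_triple hF hinj himm (d := 11) (by norm_num) a b c t
      hq.1 hq.2.1 hq.2.2)
  filter_upwards [h] with p hp t x y u hab hac hbc
  exact hp t x y u ⟨hab, hac, hbc⟩

/-- The admissible set of quadruples: pairwise distinct points of the sphere, read in charts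
`a, b, c, e`. It is open. [folklore] -/
theorem isOpen_quadrupleSet (a b c e : Fin 2) :
    IsOpen {q : (𝔼² × 𝔼²) × (𝔼² × 𝔼²) |
      stereoInv a q.1.1 ≠ stereoInv b q.1.2 ∧ stereoInv a q.1.1 ≠ stereoInv c q.2.1 ∧
      stereoInv a q.1.1 ≠ stereoInv e q.2.2 ∧ stereoInv b q.1.2 ≠ stereoInv c q.2.1 ∧
      stereoInv b q.1.2 ≠ stereoInv e q.2.2 ∧ stereoInv c q.2.1 ≠ stereoInv e q.2.2} := by
  have ha : Continuous fun q : (𝔼² × 𝔼²) × (𝔼² × 𝔼²) => stereoInv a q.1.1 :=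
    (continuous_stereoInv a).comp (continuous_fst.comp continuous_fst)
  have hb : Continuous fun q : (𝔼² × 𝔼²) × (𝔼² × 𝔼²) => stereoInv b q.1.2 :=
    (continuous_stereoInv b).comp (continuous_snd.comp continuous_fst)
  have hc : Continuous fun q : (𝔼² × 𝔼²) × (𝔼² × 𝔼²) => stereoInv c q.2.1 :=
    (continuous_stereoInv c).comp (continuous_fst.comp continuous_snd)
  have he : Continuous fun q : (𝔼² × 𝔼²) × (𝔼² × 𝔼²) => stereoInv e q.2.2 :=
    (continuous_stereoInv e).comp (continuous_snd.comp continuous_snd)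
  exact (isOpen_ne_fun ha hb).inter ((isOpen_ne_fun ha hc).inter ((isOpen_ne_fun ha he).inter
    ((isOpen_ne_fun hb hc).inter ((isOpen_ne_fun hb he).inter (isOpen_ne_fun hc he)))))

include hF hinj himm in
/-- **(C₅) a.e.: no two equal-valued pairs of critical points in one slice** (four pairwise
distinct points of the sphere), in every quadruple of charts.
[cite: CerfDiffeoSphere1968, Ch. II §2, Déf. 2 (5); §3, Prop. 7 1°] -/
theorem ae_sphere_no_two_doubles :
    ∀ᵐ p ∂(volume : Measure (MIdx 11 → ℝ)), ∀ (a b c e : Fin 2) (t : ℝ) (x y u v : 𝔼²),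
      stereoInv a x ≠ stereoInv b y → stereoInv a x ≠ stereoInv c u →
      stereoInv a x ≠ stereoInv e v → stereoInv b y ≠ stereoInv c u →
      stereoInv b y ≠ stereoInv e v → stereoInv c u ≠ stereoInv e v →
      ¬ (d1 (heightP F p a) (t, x) = 0 ∧ d1 (heightP F p b) (t, y) = 0 ∧
         d1 (heightP F p c) (t, u) = 0 ∧ d1 (heightP F p e) (t, v) = 0 ∧
         heightP F p a (t, x) = heightP F p b (t, y) ∧
         heightP F p c (t, u) = heightP F p e (t, v)) := by
  rw [ae_all_iff]; intro a
  rw [ae_all_iff]; intro b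
  rw [ae_all_iff]; intro c
  rw [ae_all_iff]; intro e
  have h := ae_no_two_doubles (contDiff_heightChart hF a) (contDiff_polyDir_chartMap hF a)
    (contDiff_heightChart hF b) (contDiff_polyDir_chartMap hF b)
    (contDiff_heightChart hF c) (contDiff_polyDir_chartMap hF c)
    (contDiff_heightChart hF e) (contDiff_polyDir_chartMap hF e) (isOpen_quadrupleSet a b c e)
    (fun t x y u v hq => surjective_D012_chartMap_quadruple hF hinj himm (d := 11) (by norm_num)
      a b c e t hq.1 hq.2.1 hq.2.2.1 hq.2.2.2.1 hq.2.2.2.2.1 hq.2.2.2.2.2)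
  filter_upwards [h] with p hp t x y u v h1 h2 h3 h4 h5 h6
  exact hp t x y u v ⟨h1, h2, h3, h4, h5, h6⟩

include hF hinj himm in
/-- **Genericity of the sheared moving sphere (Cerf 1968, Ch. II §3, Prop. 7 1°–2°, a.e. form).**
For a smooth one-parameter family `F` of maps of `ℝ³`, injective and immersive along the unit
sphere at every time, and for almost every polynomial shear `p` of degree `≤ 11`, the height
functions of the sheared spheres `t ↦ F t (S²)` satisfy, at every time and in every chart, the
seven conditions (T0′), (Déf. 1), (C₁)–(C₅) of Cerf's correct and excellent paths.
[cite: CerfDiffeoSphere1968, Ch. II §3, Lemme 9 and Prop. 7 1°–2°; §2, Déf. 1–2] -/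
theorem ae_genericity_sphere :
    ∀ᵐ p ∂(volume : Measure (MIdx 11 → ℝ)),
      (∀ (s : Fin 2) (z : ℝ × 𝔼²), d1 (heightP F p s) z = 0 → jet2 (heightP F p s) z ≠ 0) ∧
      (∀ (s : Fin 2) (z : ℝ × 𝔼²), jet2 (heightP F p s) z ≠ 0 → d1 (heightP F p s) z = 0 →
        hessDet (heightP F p s) z = 0 →
        Surjective (fderiv ℝ (fun z => (d1 (heightP F p s) z, hessDet (heightP F p s) z)) z)) ∧
      (∀ (a b : Fin 2) (t : ℝ) (x y : 𝔼²), stereoInv a x ≠ stereoInv b y →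
        d1 (heightP F p a) (t, x) = 0 → d1 (heightP F p b) (t, y) = 0 →
        heightP F p a (t, x) = heightP F p b (t, y) →
        Surjective (fderiv ℝ (fun q : ℝ × (𝔼² × 𝔼²) =>
          (d1 (heightP F p a) (q.1, q.2.1), d1 (heightP F p b) (q.1, q.2.2),
            heightP F p a (q.1, q.2.1) - heightP F p b (q.1, q.2.2))) (t, (x, y)))) ∧
      (∀ (a b : Fin 2) (t : ℝ) (x y : 𝔼²), stereoInv a x ≠ stereoInv b y →
        jet2 (heightP F p a) (t, x) ≠ 0 → jet2 (heightP F p b) (t, y) ≠ 0 →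
        ¬ (d1 (heightP F p a) (t, x) = 0 ∧ hessDet (heightP F p a) (t, x) = 0 ∧
           d1 (heightP F p b) (t, y) = 0 ∧ hessDet (heightP F p b) (t, y) = 0)) ∧
      (∀ (a b c : Fin 2) (t : ℝ) (x y u : 𝔼²),
        stereoInv a x ≠ stereoInv b y → stereoInv a x ≠ stereoInv c u →
        stereoInv b y ≠ stereoInv c u →
        ¬ (d1 (heightP F p a) (t, x) = 0 ∧ d1 (heightP F p b) (t, y) = 0 ∧
           d1 (heightP F p c) (t, u) = 0 ∧
           heightP F p a (t, x) = heightP F p b (t, y) ∧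
           heightP F p b (t, y) = heightP F p c (t, u))) ∧
      (∀ (a b c : Fin 2) (t : ℝ) (x y u : 𝔼²),
        stereoInv a x ≠ stereoInv b y → stereoInv a x ≠ stereoInv c u →
        stereoInv b y ≠ stereoInv c u → jet2 (heightP F p c) (t, u) ≠ 0 →
        ¬ (d1 (heightP F p a) (t, x) = 0 ∧ d1 (heightP F p b) (t, y) = 0 ∧
           heightP F p a (t, x) = heightP F p b (t, y) ∧
           d1 (heightP F p c) (t, u) = 0 ∧ hessDet (heightP F p c) (t, u) = 0)) ∧
      (∀ (a b c e : Fin 2) (t : ℝ) (x y u v : 𝔼²),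
        stereoInv a x ≠ stereoInv b y → stereoInv a x ≠ stereoInv c u →
        stereoInv a x ≠ stereoInv e v → stereoInv b y ≠ stereoInv c u →
        stereoInv b y ≠ stereoInv e v → stereoInv c u ≠ stereoInv e v →
        ¬ (d1 (heightP F p a) (t, x) = 0 ∧ d1 (heightP F p b) (t, y) = 0 ∧
           d1 (heightP F p c) (t, u) = 0 ∧ d1 (heightP F p e) (t, v) = 0 ∧
           heightP F p a (t, x) = heightP F p b (t, y) ∧
           heightP F p c (t, u) = heightP F p e (t, v))) := by
  filter_upwards [ae_sphere_jet2_ne_zero hF himm, ae_sphere_correct hF himm,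
    ae_sphere_transverse_double hF hinj himm, ae_sphere_atMostOne_degenerate hF hinj himm,
    ae_sphere_no_triple_value hF hinj himm, ae_sphere_no_degenerate_and_double hF hinj himm,
    ae_sphere_no_two_doubles hF hinj himm] with p h1 h2 h3 h4 h5 h6 h7
  exact ⟨h1, h2, h3, h4, h5, h6, h7⟩

end Generic

end CerfPath

end Literature.Topology.FourManifolds
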